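import Summits.QuantumFields.YangMills.Theorems.FluctuationComparisonRegPrIntLOrganTangentLawEdgeIntegrationLip
import Summits.QuantumFields.YangMills.Theorems.FluctuationComparisonRegPrIntLOrganTangentFibreWeightSquareIntegrability
import HarnessLib

/-!
# Crux `FluctuationComparisonRegPrIntL` (stmt-QuantumFields-20520, rung R3), PATH-B organ, H-currency cone — (L32) «LAW-POINT FACTS FROM PAIR-LOCAL SQUARE STABILITY» —
# the GEOMETRY-FREE, sq-READY edition of ✓(L30)'s `lawPoint_facts` (DISCHARGE-SPEC v1.4 §9 (sq3); px19 g21 09:30:46Z remark «state (N4) ALSO pair-local — every sq-consumer is pair-local»)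

Cell `ym3-torus` (YM ladder rung R3 = continuum `SU(2)` Yang–Mills on the three-torus — a RUNG: NOT d = 4, NOT infinite volume, NOT a mass gap, NOT Clay).
Width seat `ym-ust-20520-w5` (gen 24), `--supports stmt-QuantumFields-20520 --as helper`, count-neutral, no registry ∕ binder ∕ `Lines/` edit, DEFINITION-FREE,
default heartbeats.  Over ✓p814778 `wgt_normalised`, ✓p815882 `integrable_logRatio_mul_wgt_of_squareStability`, ✓p817001 `integrable_mul_wNum_of_wgt`.

WHAT.  ✓(L30) ✓p818026 derives the (I-law) dock's knit-side integrability facts from a WINDOW-GLOBAL square-stability binder `hstabW : ∀ U Xw, …` — the far-pair shape that w4 g24's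
TN-HGLOB-FRAME shows is not dischargeable from print.  The sq-programme feeds stability PAIR BY PAIR (px20 g21's `hdisp`-chaining brick (N1)–(N4): law point and value point in ONE
relational square).  This file is the pair-local interface, independent of any row text and of all lattice geometry: for ONE law point `Xw` in the `θ_j`-window and value points
with PAIR-LOCAL stability `∀ z, mwCut (Φ (Xw, z)) ≠ 0 → ∀ p, dist1 (plaqHol (Φ (U, z)) p) ≤ c·θBal_Ts` (exactly ✓p815882's `hstab`), at any real `t`:
* ★`lawPoint_facts_of_pairStab` — `Integrable (wNum … t Xw)`, `∫ wNum … t Xw ≠ 0`, `Integrable (F_U·wNum … t Xw)`, `Integrable ((F_U·F_U)·wNum … t Xw)`;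
* ★`edgeFacts_of_pairStab` — for two value points `U₁ V₁` (each pair-locally stable from `Xw`): additionally `Integrable (F_{V₁}·wNum)`, `Integrable ((F_{V₁} − F_{U₁})·wNum)`,
  `Integrable ((F_{V₁} + F_{U₁})·wNum)`, `Integrable (((F_{V₁} − F_{U₁})·(F_{V₁} + F_{U₁}))·wNum)` — the seven facts the (L1ʲ-h)∕(JV3-h′) bricks' `hpath` asks at a path point;
* ★`squareFacts_of_pairStab` — for one value point `V00`: the four facts the (L2ʲ-h)∕(JV4-h′) bricks' `hsqpath` asks at a square point.
So (L30)sq ∕ knit-sq = these lemmas at each relational path∕square point, with `PlaqSmall θ_j (X s)` from ✓p817898 + the guard and the pair-local `hstab` from the chaining brick.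

HONEST FRAMING: bookkeeping [folklore]; pair-local square stability is a HYPOTHESIS (near-pair: dischargeable from print's Prop 9 + one-bond continuity per the sq-programme — NOT done
here); nothing of Bałaban's analysis is asserted or proved; `SpreadFibreLawH(J)` ∕ `OrganDischargeInputsHJ` exactly as open; the five registered stubs of `Lines/semiclassical_s2beta.lean`,
crux 20520 and `YM3TorusSU2` are NOT proved; registry untouched; rung R3 = SU(2) YM₃ on T³ at fixed lattice data — NOT d = 4, NOT infinite volume, NOT a mass gap, NOT Clay; the
Yang–Mills mass gap is NOT proved.  [folklore].
-/

set_option autoImplicit false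

noncomputable section

namespace Summit.QuantumFields.YangMills.Theorems.OrganTangentLawPointFacts

open MeasureTheory Filter Topology Set Function
open scoped ENNReal NNReal
open Literature.MathematicalPhysics.QuantumFieldTheory.Balaban1983to89 T3ContinuumYM3Torus T3NestedUnitLaws T3UnitLawDensityEML T4Continuum BalabanUVClass
  T3UnitScaleTilt T3LevelShift T3TiltDescent
open Summit.QuantumFields.YangMills.Theorems.FluctuationComparisonRegPrIntLRunpairOrganFibreLaw (mwCut wNum wgt)
open Summit.QuantumFields.YangMills.Theorems.OrganTangentFibreWeightNormalisation (wgt_normalised)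
open Summit.QuantumFields.YangMills.Theorems.OrganTangentFibreWeightSquareIntegrability (integrable_logRatio_mul_wgt_of_squareStability)
open Summit.QuantumFields.YangMills.Theorems.OrganTangentLawEdgeIntegrationLip (integrable_mul_wNum_of_wgt)

/-- ★ **LAW-POINT FACTS FROM PAIR-LOCAL STABILITY** (geometry-free; value point `U` need not be a window point). [folklore] -/
theorem lawPoint_facts_of_pairStab (F : T3Family) (γ b₀ p₀ : ℝ) (j Ts : ℕ) (hjTs : j + 1 ≤ Ts)
    (ρ ρ' : (i : ℕ) → GaugeField (F.P i) 0 ↥(Matrix.specialUnitaryGroup (Fin 2) ℂ) → ℝ)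
    (hρm : Measurable (ρ Ts)) (hρ'm : Measurable (ρ' Ts))
    (hρc : ContinuousOn (ρ Ts) {U | PlaqSmall (θBal F.L γ b₀ p₀ Ts) U}) (hρ'c : ContinuousOn (ρ' Ts) {U | PlaqSmall (θBal F.L γ b₀ p₀ Ts) U})
    (hρpos : ∀ U, PlaqSmall (θBal F.L γ b₀ p₀ Ts) U → 0 < ρ Ts U ∧ 0 < ρ' Ts U)
    (hθ : 0 < θBal F.L γ b₀ p₀ Ts)
    (hχc : Continuous (mwCut F γ b₀ p₀ j Ts)) (hχ0 : ∀ U, 0 ≤ mwCut F γ b₀ p₀ j Ts U)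
    (hχsupp : ∀ U, mwCut F γ b₀ p₀ j Ts U ≠ 0 → ∀ (n : ℕ) (hjn : j + 1 ≤ n) (hnK : n ≤ Ts), PlaqSmall (24 / 25 * θBal F.L γ b₀ p₀ n) (descendTo F ℰp n Ts hnK U))
    (hχpos : ∀ U, (∀ (n : ℕ) (hjn : j + 1 ≤ n) (hnK : n ≤ Ts), PlaqSmall (24 / 25 * θBal F.L γ b₀ p₀ n) (descendTo F ℰp n Ts hnK U)) → 0 < mwCut F γ b₀ p₀ j Ts U)
    {Z : Type} [MeasurableSpace Z] (τ : Measure Z) [IsProbabilityMeasure τ]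
    (Φ : GaugeField (F.P j) 0 ↥(Matrix.specialUnitaryGroup (Fin 2) ℂ) × Z → GaugeField (F.P Ts) 0 ↥(Matrix.specialUnitaryGroup (Fin 2) ℂ))
    (J : GaugeField (F.P j) 0 ↥(Matrix.specialUnitaryGroup (Fin 2) ℂ) × Z → ℝ≥0)
    (hΦm : Measurable Φ) (hJm : Measurable J) (CJ : ℝ) (hJle : ∀ V z, (J (V, z) : ℝ) ≤ CJ)
    (hpos : ∀ V, PlaqSmall (θBal F.L γ b₀ p₀ j) V →
      0 < ∫⁻ z in {z | (∀ (n : ℕ) (hjn : j + 1 ≤ n) (hnK : n ≤ Ts), PlaqSmall (24 / 25 * θBal F.L γ b₀ p₀ n) (descendTo F ℰp n Ts hnK (Φ (V, z))))},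
        (J (V, z) : ℝ≥0∞) ∂τ)
    (c : ℝ) (hc : c < 1) (t : ℝ)
    (U Xw : GaugeField (F.P j) 0 ↥(Matrix.specialUnitaryGroup (Fin 2) ℂ)) (hXw : PlaqSmall (θBal F.L γ b₀ p₀ j) Xw)
    (hstab : (∀ z, mwCut F γ b₀ p₀ j Ts (Φ (Xw, z)) ≠ 0 → ∀ p, dist1 (GaugeField.plaqHol (Φ (U, z)) p) ≤ c * θBal F.L γ b₀ p₀ Ts)) :
    Integrable (fun z => wNum F γ b₀ p₀ j Ts ρ ρ' Φ J t Xw z) τ ∧ (∫ z, wNum F γ b₀ p₀ j Ts ρ ρ' Φ J t Xw z ∂τ) ≠ 0 ∧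
    Integrable (fun z => (Real.log (ρ Ts (Φ (U, z))) - Real.log (ρ' Ts (Φ (U, z)))) * wNum F γ b₀ p₀ j Ts ρ ρ' Φ J t Xw z) τ ∧
    Integrable (fun z => ((Real.log (ρ Ts (Φ (U, z))) - Real.log (ρ' Ts (Φ (U, z)))) * (Real.log (ρ Ts (Φ (U, z))) - Real.log (ρ' Ts (Φ (U, z))))) * wNum F γ b₀ p₀ j Ts ρ ρ' Φ J t Xw z) τ := by
  obtain ⟨hiW, hmass, -, -⟩ := wgt_normalised F γ b₀ p₀ j Ts hjTs ρ ρ' hρm hρ'm hρc hρ'c hρpos hθ hχc hχ0 hχsupp hχpos τ Φ J hΦm hJm CJ hJle hpos t Xw hXw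
  have hZ : (∫ z, wNum F γ b₀ p₀ j Ts ρ ρ' Φ J t Xw z ∂τ) ≠ 0 := hmass.ne'
  obtain ⟨h1, h2⟩ := integrable_logRatio_mul_wgt_of_squareStability F γ b₀ p₀ j Ts hjTs ρ ρ' hρm hρ'm hρc hρ'c hρpos hθ hχc hχ0 hχsupp hχpos τ Φ J hΦm hJm CJ hJle hpos c hc t U Xw hXw hstab
  refine ⟨hiW, hZ, integrable_mul_wNum_of_wgt F γ b₀ p₀ j Ts ρ ρ' τ Φ J t Xw _ hZ h1, ?_⟩
  have h2' : Integrable (fun z => ((Real.log (ρ Ts (Φ (U, z))) - Real.log (ρ' Ts (Φ (U, z)))) * (Real.log (ρ Ts (Φ (U, z))) - Real.log (ρ' Ts (Φ (U, z))))) * (wgt F γ b₀ p₀ j Ts ρ ρ' τ Φ J t) Xw z) τ := by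
    have e : (fun z => ((Real.log (ρ Ts (Φ (U, z))) - Real.log (ρ' Ts (Φ (U, z)))) * (Real.log (ρ Ts (Φ (U, z))) - Real.log (ρ' Ts (Φ (U, z))))) * (wgt F γ b₀ p₀ j Ts ρ ρ' τ Φ J t) Xw z)
        = fun z => (Real.log (ρ Ts (Φ (U, z))) - Real.log (ρ' Ts (Φ (U, z)))) ^ 2 * wgt F γ b₀ p₀ j Ts ρ ρ' τ Φ J t Xw z := by
      funext z; ring
    rw [e]; exact h2
  exact integrable_mul_wNum_of_wgt F γ b₀ p₀ j Ts ρ ρ' τ Φ J t Xw _ hZ h2'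

/-- ★ **EDGE FACTS**: the seven integrability ∕ mass facts the (L1ʲ-h)∕(JV3-h′) bricks ask at one law point, from pair-local stability of the two value points `U₁ V₁`. [folklore] -/
theorem edgeFacts_of_pairStab (F : T3Family) (γ b₀ p₀ : ℝ) (j Ts : ℕ) (hjTs : j + 1 ≤ Ts)
    (ρ ρ' : (i : ℕ) → GaugeField (F.P i) 0 ↥(Matrix.specialUnitaryGroup (Fin 2) ℂ) → ℝ)
    (hρm : Measurable (ρ Ts)) (hρ'm : Measurable (ρ' Ts))
    (hρc : ContinuousOn (ρ Ts) {U | PlaqSmall (θBal F.L γ b₀ p₀ Ts) U}) (hρ'c : ContinuousOn (ρ' Ts) {U | PlaqSmall (θBal F.L γ b₀ p₀ Ts) U})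
    (hρpos : ∀ U, PlaqSmall (θBal F.L γ b₀ p₀ Ts) U → 0 < ρ Ts U ∧ 0 < ρ' Ts U)
    (hθ : 0 < θBal F.L γ b₀ p₀ Ts)
    (hχc : Continuous (mwCut F γ b₀ p₀ j Ts)) (hχ0 : ∀ U, 0 ≤ mwCut F γ b₀ p₀ j Ts U)
    (hχsupp : ∀ U, mwCut F γ b₀ p₀ j Ts U ≠ 0 → ∀ (n : ℕ) (hjn : j + 1 ≤ n) (hnK : n ≤ Ts), PlaqSmall (24 / 25 * θBal F.L γ b₀ p₀ n) (descendTo F ℰp n Ts hnK U))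
    (hχpos : ∀ U, (∀ (n : ℕ) (hjn : j + 1 ≤ n) (hnK : n ≤ Ts), PlaqSmall (24 / 25 * θBal F.L γ b₀ p₀ n) (descendTo F ℰp n Ts hnK U)) → 0 < mwCut F γ b₀ p₀ j Ts U)
    {Z : Type} [MeasurableSpace Z] (τ : Measure Z) [IsProbabilityMeasure τ]
    (Φ : GaugeField (F.P j) 0 ↥(Matrix.specialUnitaryGroup (Fin 2) ℂ) × Z → GaugeField (F.P Ts) 0 ↥(Matrix.specialUnitaryGroup (Fin 2) ℂ))
    (J : GaugeField (F.P j) 0 ↥(Matrix.specialUnitaryGroup (Fin 2) ℂ) × Z → ℝ≥0)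
    (hΦm : Measurable Φ) (hJm : Measurable J) (CJ : ℝ) (hJle : ∀ V z, (J (V, z) : ℝ) ≤ CJ)
    (hpos : ∀ V, PlaqSmall (θBal F.L γ b₀ p₀ j) V →
      0 < ∫⁻ z in {z | (∀ (n : ℕ) (hjn : j + 1 ≤ n) (hnK : n ≤ Ts), PlaqSmall (24 / 25 * θBal F.L γ b₀ p₀ n) (descendTo F ℰp n Ts hnK (Φ (V, z))))},
        (J (V, z) : ℝ≥0∞) ∂τ)
    (c : ℝ) (hc : c < 1) (t : ℝ)
    (U₁ V₁ Xw : GaugeField (F.P j) 0 ↥(Matrix.specialUnitaryGroup (Fin 2) ℂ)) (hXw : PlaqSmall (θBal F.L γ b₀ p₀ j) Xw)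
    (hstabU : (∀ z, mwCut F γ b₀ p₀ j Ts (Φ (Xw, z)) ≠ 0 → ∀ p, dist1 (GaugeField.plaqHol (Φ (U₁, z)) p) ≤ c * θBal F.L γ b₀ p₀ Ts)) (hstabV : (∀ z, mwCut F γ b₀ p₀ j Ts (Φ (Xw, z)) ≠ 0 → ∀ p, dist1 (GaugeField.plaqHol (Φ (V₁, z)) p) ≤ c * θBal F.L γ b₀ p₀ Ts)) :
    Integrable (fun z => wNum F γ b₀ p₀ j Ts ρ ρ' Φ J t Xw z) τ ∧ (∫ z, wNum F γ b₀ p₀ j Ts ρ ρ' Φ J t Xw z ∂τ) ≠ 0 ∧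
    Integrable (fun z => (Real.log (ρ Ts (Φ (U₁, z))) - Real.log (ρ' Ts (Φ (U₁, z)))) * wNum F γ b₀ p₀ j Ts ρ ρ' Φ J t Xw z) τ ∧ Integrable (fun z => (Real.log (ρ Ts (Φ (V₁, z))) - Real.log (ρ' Ts (Φ (V₁, z)))) * wNum F γ b₀ p₀ j Ts ρ ρ' Φ J t Xw z) τ ∧
    Integrable (fun z => ((Real.log (ρ Ts (Φ (V₁, z))) - Real.log (ρ' Ts (Φ (V₁, z)))) - (Real.log (ρ Ts (Φ (U₁, z))) - Real.log (ρ' Ts (Φ (U₁, z))))) * wNum F γ b₀ p₀ j Ts ρ ρ' Φ J t Xw z) τ ∧ Integrable (fun z => ((Real.log (ρ Ts (Φ (V₁, z))) - Real.log (ρ' Ts (Φ (V₁, z)))) + (Real.log (ρ Ts (Φ (U₁, z))) - Real.log (ρ' Ts (Φ (U₁, z))))) * wNum F γ b₀ p₀ j Ts ρ ρ' Φ J t Xw z) τ ∧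
    Integrable (fun z => (((Real.log (ρ Ts (Φ (V₁, z))) - Real.log (ρ' Ts (Φ (V₁, z)))) - (Real.log (ρ Ts (Φ (U₁, z))) - Real.log (ρ' Ts (Φ (U₁, z))))) * ((Real.log (ρ Ts (Φ (V₁, z))) - Real.log (ρ' Ts (Φ (V₁, z)))) + (Real.log (ρ Ts (Φ (U₁, z))) - Real.log (ρ' Ts (Φ (U₁, z)))))) * wNum F γ b₀ p₀ j Ts ρ ρ' Φ J t Xw z) τ := by
  have fU := lawPoint_facts_of_pairStab F γ b₀ p₀ j Ts hjTs ρ ρ' hρm hρ'm hρc hρ'c hρpos hθ hχc hχ0 hχsupp hχpos τ Φ J hΦm hJm CJ hJle hpos c hc t U₁ Xw hXw hstabU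
  have fV := lawPoint_facts_of_pairStab F γ b₀ p₀ j Ts hjTs ρ ρ' hρm hρ'm hρc hρ'c hρpos hθ hχc hχ0 hχsupp hχpos τ Φ J hΦm hJm CJ hJle hpos c hc t V₁ Xw hXw hstabV
  refine ⟨fU.1, fU.2.1, fU.2.2.1, fV.2.2.1, ?_, ?_, ?_⟩
  · have e : (fun z => ((Real.log (ρ Ts (Φ (V₁, z))) - Real.log (ρ' Ts (Φ (V₁, z)))) - (Real.log (ρ Ts (Φ (U₁, z))) - Real.log (ρ' Ts (Φ (U₁, z))))) * wNum F γ b₀ p₀ j Ts ρ ρ' Φ J t Xw z) = fun z => (Real.log (ρ Ts (Φ (V₁, z))) - Real.log (ρ' Ts (Φ (V₁, z)))) * wNum F γ b₀ p₀ j Ts ρ ρ' Φ J t Xw z - (Real.log (ρ Ts (Φ (U₁, z))) - Real.log (ρ' Ts (Φ (U₁, z)))) * wNum F γ b₀ p₀ j Ts ρ ρ' Φ J t Xw z := by funext z; ring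
    rw [e]; exact fV.2.2.1.sub fU.2.2.1
  · have e : (fun z => ((Real.log (ρ Ts (Φ (V₁, z))) - Real.log (ρ' Ts (Φ (V₁, z)))) + (Real.log (ρ Ts (Φ (U₁, z))) - Real.log (ρ' Ts (Φ (U₁, z))))) * wNum F γ b₀ p₀ j Ts ρ ρ' Φ J t Xw z) = fun z => (Real.log (ρ Ts (Φ (V₁, z))) - Real.log (ρ' Ts (Φ (V₁, z)))) * wNum F γ b₀ p₀ j Ts ρ ρ' Φ J t Xw z + (Real.log (ρ Ts (Φ (U₁, z))) - Real.log (ρ' Ts (Φ (U₁, z)))) * wNum F γ b₀ p₀ j Ts ρ ρ' Φ J t Xw z := by funext z; ring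
    rw [e]; exact fV.2.2.1.add fU.2.2.1
  · have e : (fun z => (((Real.log (ρ Ts (Φ (V₁, z))) - Real.log (ρ' Ts (Φ (V₁, z)))) - (Real.log (ρ Ts (Φ (U₁, z))) - Real.log (ρ' Ts (Φ (U₁, z))))) * ((Real.log (ρ Ts (Φ (V₁, z))) - Real.log (ρ' Ts (Φ (V₁, z)))) + (Real.log (ρ Ts (Φ (U₁, z))) - Real.log (ρ' Ts (Φ (U₁, z)))))) * wNum F γ b₀ p₀ j Ts ρ ρ' Φ J t Xw z) = fun z => ((Real.log (ρ Ts (Φ (V₁, z))) - Real.log (ρ' Ts (Φ (V₁, z)))) * (Real.log (ρ Ts (Φ (V₁, z))) - Real.log (ρ' Ts (Φ (V₁, z))))) * wNum F γ b₀ p₀ j Ts ρ ρ' Φ J t Xw z - ((Real.log (ρ Ts (Φ (U₁, z))) - Real.log (ρ' Ts (Φ (U₁, z)))) * (Real.log (ρ Ts (Φ (U₁, z))) - Real.log (ρ' Ts (Φ (U₁, z))))) * wNum F γ b₀ p₀ j Ts ρ ρ' Φ J t Xw z := by funext z; ring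
    rw [e]; exact fV.2.2.2.sub fU.2.2.2

/-- ★ **SQUARE FACTS**: the four facts the (L2ʲ-h)∕(JV4-h′) bricks ask at one law point, from pair-local stability of the base value point `V00`. [folklore] -/
theorem squareFacts_of_pairStab (F : T3Family) (γ b₀ p₀ : ℝ) (j Ts : ℕ) (hjTs : j + 1 ≤ Ts)
    (ρ ρ' : (i : ℕ) → GaugeField (F.P i) 0 ↥(Matrix.specialUnitaryGroup (Fin 2) ℂ) → ℝ)
    (hρm : Measurable (ρ Ts)) (hρ'm : Measurable (ρ' Ts))
    (hρc : ContinuousOn (ρ Ts) {U | PlaqSmall (θBal F.L γ b₀ p₀ Ts) U}) (hρ'c : ContinuousOn (ρ' Ts) {U | PlaqSmall (θBal F.L γ b₀ p₀ Ts) U})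
    (hρpos : ∀ U, PlaqSmall (θBal F.L γ b₀ p₀ Ts) U → 0 < ρ Ts U ∧ 0 < ρ' Ts U)
    (hθ : 0 < θBal F.L γ b₀ p₀ Ts)
    (hχc : Continuous (mwCut F γ b₀ p₀ j Ts)) (hχ0 : ∀ U, 0 ≤ mwCut F γ b₀ p₀ j Ts U)
    (hχsupp : ∀ U, mwCut F γ b₀ p₀ j Ts U ≠ 0 → ∀ (n : ℕ) (hjn : j + 1 ≤ n) (hnK : n ≤ Ts), PlaqSmall (24 / 25 * θBal F.L γ b₀ p₀ n) (descendTo F ℰp n Ts hnK U))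
    (hχpos : ∀ U, (∀ (n : ℕ) (hjn : j + 1 ≤ n) (hnK : n ≤ Ts), PlaqSmall (24 / 25 * θBal F.L γ b₀ p₀ n) (descendTo F ℰp n Ts hnK U)) → 0 < mwCut F γ b₀ p₀ j Ts U)
    {Z : Type} [MeasurableSpace Z] (τ : Measure Z) [IsProbabilityMeasure τ]
    (Φ : GaugeField (F.P j) 0 ↥(Matrix.specialUnitaryGroup (Fin 2) ℂ) × Z → GaugeField (F.P Ts) 0 ↥(Matrix.specialUnitaryGroup (Fin 2) ℂ))
    (J : GaugeField (F.P j) 0 ↥(Matrix.specialUnitaryGroup (Fin 2) ℂ) × Z → ℝ≥0)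
    (hΦm : Measurable Φ) (hJm : Measurable J) (CJ : ℝ) (hJle : ∀ V z, (J (V, z) : ℝ) ≤ CJ)
    (hpos : ∀ V, PlaqSmall (θBal F.L γ b₀ p₀ j) V →
      0 < ∫⁻ z in {z | (∀ (n : ℕ) (hjn : j + 1 ≤ n) (hnK : n ≤ Ts), PlaqSmall (24 / 25 * θBal F.L γ b₀ p₀ n) (descendTo F ℰp n Ts hnK (Φ (V, z))))},
        (J (V, z) : ℝ≥0∞) ∂τ)
    (c : ℝ) (hc : c < 1) (t : ℝ)
    (V00 Xw : GaugeField (F.P j) 0 ↥(Matrix.specialUnitaryGroup (Fin 2) ℂ)) (hXw : PlaqSmall (θBal F.L γ b₀ p₀ j) Xw)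
    (hstab : (∀ z, mwCut F γ b₀ p₀ j Ts (Φ (Xw, z)) ≠ 0 → ∀ p, dist1 (GaugeField.plaqHol (Φ (V00, z)) p) ≤ c * θBal F.L γ b₀ p₀ Ts)) :
    Integrable (fun z => wNum F γ b₀ p₀ j Ts ρ ρ' Φ J t Xw z) τ ∧ Integrable (fun z => (Real.log (ρ Ts (Φ (V00, z))) - Real.log (ρ' Ts (Φ (V00, z)))) * wNum F γ b₀ p₀ j Ts ρ ρ' Φ J t Xw z) τ ∧
    Integrable (fun z => ((Real.log (ρ Ts (Φ (V00, z))) - Real.log (ρ' Ts (Φ (V00, z)))) * (Real.log (ρ Ts (Φ (V00, z))) - Real.log (ρ' Ts (Φ (V00, z))))) * wNum F γ b₀ p₀ j Ts ρ ρ' Φ J t Xw z) τ ∧ (∫ z, wNum F γ b₀ p₀ j Ts ρ ρ' Φ J t Xw z ∂τ) ≠ 0 := by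
  have f := lawPoint_facts_of_pairStab F γ b₀ p₀ j Ts hjTs ρ ρ' hρm hρ'm hρc hρ'c hρpos hθ hχc hχ0 hχsupp hχpos τ Φ J hΦm hJm CJ hJle hpos c hc t V00 Xw hXw hstab
  exact ⟨f.1, f.2.2.1, f.2.2.2, f.2.1⟩

end Summit.QuantumFields.YangMills.Theorems.OrganTangentLawPointFacts

end
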